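import Summits.QuantumFields.BalabanUV.T4Continuum.Spine.NE2BalabanThreshold

/-!
# T⁴ programme, spine node NE2 (U1a), tier B rows B5 × B7 — ROOT B's END AT THE FLAT BACKGROUND:
# c5 IN THE KERNEL (`P(1) = 0` for the typed perturbation of record) and NON-VACUITY of the displayed binders

NE2 formalisation swarm `b2b-balaban-t4-ne2-formalise-*`, leaf prover 03 (row B5 lineage; leaf-proposed support row «B7.w END WITNESS (flat)»,
INTENT CLAIMS.log l.8648).  ROOT B's END of record is `Spine/NE2BalabanThreshold.balaban_final_rate_of_regular` (leaf-08, p212305): for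
site-based bond transporters `Rg`, displayed binders `hreg : RegularTransporters L M (liftR L M Rg) α β` (row B5's (3.35)-shape class),
`hNE3 : LocalRate (bgReadings L M (regClass L M (liftR L M Rg))) C L⁻¹` (node NE3 BY NAME, OPEN), `0 < a′`, `α ≤ η`, `β ≤ η`, `η ≤ η⋆` ⟹ the King-averaged
unit-lattice covariances of `Δ_a^{(k)} ⊗ 1 + P_k(Rg)` converge with rate `L^{−k}`, `P(Rg) = balabanPert (liftR Rg) (gaugeSlot Rg (QuT (siteT Rg)) Q1 a′)`.
The claim table's framing (LEAVES.md header, c5) says every tier-B theorem is «about the typed operator `calDalev ⊗ₖ 1 + P(U)` with `P(1) = 0` BY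
CONSTRUCTION».  This file makes both halves of that sentence kernel facts for the END of record, at the FLAT background
`Rg ≡ 1` (`GaugeTermPerturbationLaw.oneR`):
 * §1–§2 **`balabanPert_flat`**: `P(1) = 0` — the covariant-Laplacian summand vanishes (`covDc_one`, `covLapC_one`, `covPertC_flat`, new), the
   covariant-averaging summand vanishes (leaf-08's `NE2BalabanRoot.avgPert_trivial` BY NAME), and the gauge slot vanishes (`siteT_oneR` from
   leaf-03's `siteTr_one`, leaf-05's `QuT_one`, then `gaugeTerm 1 Q1 Q1 = gaugeP − gaugeP`);
 * §3 **the displayed binders are JOINTLY SATISFIABLE**: `regularTransporters_flat : RegularTransporters L M (liftR L M oneR) 0 0` (row B5's class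
   contains the flat background with `α = β = 0`), `connTower_flat` ∕ `dconnTower_flat` (the coefficient towers read by node NE3 vanish) and
   **`localRate_flat`**: node NE3's hypothesis SHAPE `LocalRate (bgReadings (regClass (liftR oneR))) C θ` holds for every `C, θ ≥ 0` — a
   statement about the SHAPE at the flat background only, NOT about node NE3 for any non-trivial background;
 * §4 **`balaban_final_rate_flat (hL : 2 ≤ L) (hd : 1 ≤ d) (ha′ : 0 < a′)`**: ROOT B's END fires with NO hypothesis left (`η := etaStar > 0`,
   leaf-08's `etaStar_pos`), and **`free_rate_of_balaban_final_flat`**: by §2 it READS as the η-rate `L^{−k}` of the FREE King tower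
   `(Δ_a^{(k)} ⊗ 1)⁻¹` in tier A's currency — the `U = 1` specialisation of the whole B2–B7 chain is the right statement.

HONEST FRAMING (T4-DAG p. 1).  Finite-dimensional algebra at `U = 1` and satisfiability of hypothesis SHAPES; asserts NOTHING about Bałaban's
minimisers `U_k(V)` (no B0, c5), nothing about node NE3 away from the flat background, and changes no conditionality of ROOT B for `U ≠ 1`
(CONDITIONAL on node NE3, OPEN, and on row B5's class); GLOBAL small field; finite torus, linear layer, operator norm; NOT [B9] (3.23)–(3.26)
as printed; NE2 (U1a) is NOT PROVED by this file (c1 with the carver); spine PROVED 0/9 unchanged; NOT infinite volume, NOT a mass gap, NOT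
Clay, NOT summit progress.  HONEST DEPENDENCY: continuum YM on T⁴ ⇐ BetaPertH ∧ nine spine estimates (0/9 proved); BetaPertH ⇐ (D1) ∧ (D4) ∧
CAP+tail; G-an2-4 gates asym, D1 and NE2/3/4.  ABSOLUTE RULE: no internally-minted statement enters as a cited fact; no `[cite:]` tag is used
as a fact; no `def … : Prop` fact; no `sorry`.
-/

noncomputable section

open scoped BigOperators ComplexConjugate Matrix Matrix.Norms.L2Operator Kronecker
open Filter Topology

namespace Summit.QuantumFields.BalabanUV.T4Continuum.NE2BalabanFlatWitness

open Literature.MathematicalPhysics.QuantumFieldTheory.Balaban1983to89.B5Prop11Plancherel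
open Literature.MathematicalPhysics.QuantumFieldTheory.Balaban1983to89.B5G183RateUnitTower (lev lev_neZero)
open Literature.MathematicalPhysics.QuantumFieldTheory.Balaban1983to89.T4EtaRateMin (LocalRate)
open Summit.QuantumFields.BalabanUV.T4Continuum
open Summit.QuantumFields.BalabanUV.T4Continuum.CovariantAveragingTower (TowerLimitRate)
open Summit.QuantumFields.BalabanUV.T4Continuum.BalabanAveragedTowerUnit (idx Qlev)
open Summit.QuantumFields.BalabanUV.T4Continuum.BackgroundResolventTower
open Summit.QuantumFields.BalabanUV.T4Continuum.KingPairingPlantedLaw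
open Summit.QuantumFields.BalabanUV.T4Continuum.BlockMultiplication (siteMul siteMul_one)
open Summit.QuantumFields.BalabanUV.T4Continuum.KroneckerLift (sub_kronecker)
open Summit.QuantumFields.BalabanUV.T4Continuum.GramPerturbationLaw (C2gram)
open Summit.QuantumFields.BalabanUV.T4Continuum.NE2FromNE3 (bgReadings entryAt)
open Summit.QuantumFields.BalabanUV.T4Continuum.RegularBackgroundTower (RegularTransporters connTower dconnTower regClass betaNE3)
open Summit.QuantumFields.BalabanUV.T4Continuum.ColourCovariantLaplacian (covDc covLapC lapC covPertC)
open Summit.QuantumFields.BalabanUV.T4Continuum.GaugeTermPerturbationLaw (oneR gaugeTerm)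
open Summit.QuantumFields.BalabanUV.T4Continuum.GaugeTermScalarData (QuT Q1 QuT_one)
open Summit.QuantumFields.BalabanUV.T4Continuum.RegularSiteTransporters (siteT siteTr_one)
open Summit.QuantumFields.BalabanUV.T4Continuum.NestedContourTransport (theta0)
open Summit.QuantumFields.BalabanUV.T4Continuum.NE2BalabanLayer (tierBPert)
open Summit.QuantumFields.BalabanUV.T4Continuum.NE2BalabanRoot (avgPert avgPert_trivial balabanPert)
open Summit.QuantumFields.BalabanUV.T4Continuum.NE2BalabanGauge (gaugeSlot liftR liftR_apply)
open Summit.QuantumFields.BalabanUV.T4Continuum.NE2BalabanLayerSharp (kappaBs C2Bs KstarR)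
open Summit.QuantumFields.BalabanUV.T4Continuum.NE2BalabanWiring (epsR CdeltaR)
open Summit.QuantumFields.BalabanUV.T4Continuum.NE2BalabanFinal (kappa4F C4F)
open Summit.QuantumFields.BalabanUV.T4Continuum.NE2BalabanThreshold (etaStar etaStar_pos balaban_final_rate_of_regular)

/-! ## §1 One level: the covariant difference and Laplacian at identity transporters -/

section OneLevel

variable {d : ℕ} (Nf : Fin d → ℕ) [hNf : ∀ μ, NeZero (Nf μ)] {o : Type*} [Fintype o] [DecidableEq o]

/-- at identity transporters the covariant forward difference IS the free one, lifted: `∇^1_ν = ∇_ν ⊗ 1`. [folklore] -/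
theorem covDc_one (c : ℂ) (ν : Fin d) :
    covDc Nf c (fun _ _ => (1 : Matrix o o ℂ)) ν = fdiff Nf c ν ⊗ₖ (1 : Matrix o o ℂ) := by
  unfold covDc
  rw [siteMul_one, Matrix.one_mul, fdiff, Matrix.smul_kronecker, sub_kronecker, Matrix.one_kronecker_one]

/-- at identity transporters the covariant vector Laplacian IS the free one, lifted: `Δ^1 = Δ ⊗ 1` (as the matrix `lapC`). [folklore] -/
theorem covLapC_one (c : ℂ) : covLapC Nf c (fun _ _ => (1 : Matrix o o ℂ)) = lapC Nf c := by
  rw [covLapC, lapC]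
  simp only [covDc_one]

end OneLevel

/-! ## §2 Along the tower: the typed perturbation of record vanishes at the flat background (`P(1) = 0`, c5) -/

variable {d : ℕ} (L : ℕ) [NeZero L] (M : Fin d → ℕ) [hM : ∀ μ, NeZero (M μ)] (a : ℝ) (ha : 0 < a)
variable {o : Type*} [Fintype o] [DecidableEq o]

omit [NeZero L] hM [Fintype o] in
/-- the lift of the flat site-based transporters is the flat 1-form-indexed tower (definitional). [folklore] -/
theorem liftR_oneR : liftR L M (oneR L M (o := o)) = fun _ _ _ => (1 : Matrix o o ℂ) := rfl

/-- **the covariant-Laplacian summand vanishes at the flat background**: `Δ^{1} − Δ ⊗ 1 = 0` at every level. [folklore] -/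
theorem covPertC_flat (k : ℕ) : covPertC L M (liftR L M (oneR L M (o := o))) k = 0 := by
  rw [liftR_oneR, covPertC]
  exact sub_eq_zero.mpr (covLapC_one (fine (lev L k) M) ((lev L k : ℕ) : ℂ))

omit [NeZero L] in
/-- **the covariant-averaging summand vanishes at the flat background** (leaf-08's `avgPert_trivial` BY NAME). [folklore] -/
theorem avgPert_flat (k : ℕ) : avgPert L M a (liftR L M (oneR L M (o := o))) k = 0 := by
  rw [liftR_oneR]
  exact avgPert_trivial L M a k

/-- Bałaban's site transports along the (1.7) legs of flat bond transporters are the identity (leaf-03's `siteTr_one`). [folklore] -/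
theorem siteT_oneR : siteT L M (oneR L M (o := o)) = fun k (_ : Tor (fine (lev L k) M)) => (1 : Matrix o o ℂ) := by
  funext k x
  exact siteTr_one (lev L k) M x

/-- **the B4 summand vanishes at the flat background**: with identity site transports the transported averaging is the free one
(`QuT_one`), so `gaugeTerm 1 (QuT (siteT 1)) Q1 = gaugeP 1 Q1 − gaugeP 1 Q1 = 0`. [folklore] -/
theorem gaugeTerm_flat (a' : ℝ) (k : ℕ) :
    gaugeTerm L M (oneR L M (o := o)) (QuT L M o (siteT L M (oneR L M (o := o)))) (Q1 L M o) a' k = 0 := by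
  rw [siteT_oneR, QuT_one, gaugeTerm, sub_self]

/-- the gauge slot `P₄ = −gaugeTerm` vanishes at the flat background. [folklore] -/
theorem gaugeSlot_flat (a' : ℝ) (k : ℕ) :
    gaugeSlot L M (oneR L M (o := o)) (QuT L M o (siteT L M (oneR L M (o := o)))) (Q1 L M o) a' k = 0 := by
  rw [gaugeSlot, gaugeTerm_flat, neg_zero]

/-- **c5 IN THE KERNEL FOR THE PERTURBATION OF RECORD**: at the flat background `Rg ≡ 1` the typed tier-B perturbation of ROOT B's END —
covariant Laplacian minus free Laplacian, plus Bałaban's covariant-averaging summand, plus the gauge slot with site transports along the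
(1.7) legs — is IDENTICALLY ZERO: `P(1) = 0`.  (So every tier-B theorem about `calDalev ⊗ₖ 1 + P(Rg)` is, at `Rg ≡ 1`, a theorem about the
free operator `Δ_a ⊗ 1`; nothing about Bałaban's minimisers is asserted.) [folklore] -/
theorem balabanPert_flat (a' : ℝ) :
    balabanPert L M a (liftR L M (oneR L M (o := o)))
        (gaugeSlot L M (oneR L M (o := o)) (QuT L M o (siteT L M (oneR L M (o := o)))) (Q1 L M o) a')
      = fun _ => 0 := by
  funext k
  rw [balabanPert, tierBPert, covPertC_flat, avgPert_flat, gaugeSlot_flat, add_zero, add_zero]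

/-! ## §3 The displayed binders of ROOT B's END hold at the flat background -/

omit [NeZero L] hM [Fintype o] in
/-- the connection tower read by node NE3 vanishes at the flat background: `w^{(k)} = L^k(1 − 1) = 0`. [folklore] -/
theorem connTower_flat (k : ℕ) (ν : Fin d) (i : idx L M k) : connTower L M (liftR L M (oneR L M (o := o))) k ν i = 0 := by
  show ((lev L k : ℕ) : ℂ) • ((1 : Matrix o o ℂ) - 1) = 0
  rw [sub_self, smul_zero]

omit [NeZero L] hM [Fintype o] in
/-- the lattice-derivative tower read by node NE3 vanishes at the flat background. [folklore] -/
theorem dconnTower_flat (k : ℕ) (ν : Fin d) (i : idx L M k) : dconnTower L M (liftR L M (oneR L M (o := o))) k ν i = 0 := by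
  rw [dconnTower, connTower_flat, connTower_flat, sub_self, smul_zero]

omit [NeZero L] hM [Fintype o] in
/-- node NE3's class for this summand at the flat background is the singleton `{0}`. [folklore] -/
theorem regClass_flat :
    regClass L M (liftR L M (oneR L M (o := o))) = {fun _ _ _ => (0 : Matrix o o ℂ)} := by
  have h1 : connTower L M (liftR L M (oneR L M (o := o))) = fun _ _ _ => (0 : Matrix o o ℂ) := by
    funext k ν i; exact connTower_flat L M k ν i
  have h2 : dconnTower L M (liftR L M (oneR L M (o := o))) = fun _ _ _ => (0 : Matrix o o ℂ) := by
    funext k ν i; exact dconnTower_flat L M k ν i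
  rw [regClass, h1, h2, Set.pair_eq_singleton]

omit [NeZero L] hM in
/-- **ROW B5's CLASS CONTAINS THE FLAT BACKGROUND** with sizes `α = β = 0`. [folklore] -/
theorem regularTransporters_flat : RegularTransporters L M (liftR L M (oneR L M (o := o))) 0 0 where
  nonneg := ⟨le_rfl, le_rfl⟩
  size k ν i := by
    show ‖((lev L k : ℕ) : ℂ) • ((1 : Matrix o o ℂ) - 1)‖ ≤ 0
    rw [sub_self, smul_zero, norm_zero]
  lipschitz k ν μ i := by
    show ‖((lev L k : ℕ) : ℂ) • ((1 : Matrix o o ℂ) - 1)‖ ≤ 0 / (lev L k : ℕ)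
    rw [sub_self, smul_zero, norm_zero, zero_div]

omit [NeZero L] hM [Fintype o] in
/-- **NODE NE3's HYPOTHESIS SHAPE HOLDS AT THE FLAT BACKGROUND** for every `C, θ ≥ 0`: the readings of the class `{0}` are constant (zero)
along the tower.  A statement about the SHAPE `LocalRate (bgReadings …)` at `Rg ≡ 1` ONLY — node NE3 itself (non-trivial backgrounds) is
OPEN and untouched. [folklore] -/
theorem localRate_flat {C θ : ℝ} (hC : 0 ≤ C) (hθ : 0 ≤ θ) :
    LocalRate (bgReadings L M (regClass L M (liftR L M (oneR L M (o := o))))) C θ := by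
  intro k V hV s
  change V ∈ regClass L M (liftR L M (oneR L M (o := o))) at hV
  rw [regClass_flat, Set.mem_singleton_iff] at hV
  subst hV
  simp only [bgReadings, entryAt, Matrix.zero_apply, Complex.zero_re, Complex.zero_im, ite_self, sub_self, abs_zero]
  positivity

/-! ## §4 ROOT B's END at the flat background: no hypothesis left, and it is the free tower's rate -/

/-- **NON-VACUITY OF ROOT B's END** (`L ≥ 2`, `d ≥ 1`, `a′ > 0`): at the flat background `Rg ≡ 1` every displayed binder of
`NE2BalabanThreshold.balaban_final_rate_of_regular` is DISCHARGED — `hreg := regularTransporters_flat` (`α = β = 0`), `hC := le_rfl` (`C = 0`),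
`hNE3 := localRate_flat`, `η := etaStar o d a a′` with `0 ≤ η⋆` from leaf-08's `etaStar_pos` — so the END's conclusion holds with NO hypothesis:
the binder set {hreg, hNE3, 0 < a′, α ≤ η, β ≤ η, η ≤ η⋆} is jointly satisfiable.  NOT a statement about any non-trivial background; NE2 NOT
proved. [folklore] -/
theorem balaban_final_rate_flat (hL : 2 ≤ L) (hd : 1 ≤ d) {a' : ℝ} (ha' : 0 < a') :
    TowerLimitRate (fun k => Qlev L M k ⊗ₖ (1 : Matrix o o ℂ)) ((L : ℝ) ^ d)
      (fun k => (calDalev L M a ha k ⊗ₖ (1 : Matrix o o ℂ)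
        + balabanPert L M a (liftR L M (oneR L M (o := o)))
            (gaugeSlot L M (oneR L M (o := o)) (QuT L M o (siteT L M (oneR L M (o := o)))) (Q1 L M o) a') k)⁻¹)
      (Cpert (kappaBs o d a 0 0 (a * (epsR o d 0 * (2 + epsR o d 0) * Cst d a)) (kappa4F d a a' 0 0))
        (2 * d * Cst d a) (CJ d a)
        (C2Bs o d L a 0 0 0
          (a * C2gram (Cst d a) 1 (epsR o d 0) (2 * d * Cst d a) (CJ d a) (Cst d a) (CdeltaR o d a 0 (theta0 d 0 (betaNE3 o 0))))
          (C4F o d L a a' 0 0 0)) 0 1) ((L : ℝ)⁻¹) := by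
  have hη := etaStar_pos (o := o) (d := d) a ha.le ha'.le
  have hθ : 0 ≤ ((L : ℝ)⁻¹) := inv_nonneg.mpr (Nat.cast_nonneg L)
  exact balaban_final_rate_of_regular L M a ha hL hd (regularTransporters_flat L M) le_rfl
    (localRate_flat L M le_rfl hθ) ha' hη.le hη.le le_rfl

/-- **THE `U = 1` SPECIALISATION OF THE WHOLE B2–B7 CHAIN IS THE FREE TOWER's η-RATE** (`L ≥ 2`, `d ≥ 1`, `a′ > 0`): by `balabanPert_flat`
the unconditional flat instance of ROOT B's END READS — the lifted King-averaged unit-lattice covariances of the FREE operators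
`(Δ_a^{(k)} ⊗ 1)⁻¹` converge with rate `L^{−k}` (tier A's currency, with ROOT B's constants at `α = β = C = 0`).  Consistency check of the
assembly against the free King tower; nothing new about `U ≠ 1`; NE2 NOT proved. [folklore] -/
theorem free_rate_of_balaban_final_flat (hL : 2 ≤ L) (hd : 1 ≤ d) {a' : ℝ} (ha' : 0 < a') :
    TowerLimitRate (fun k => Qlev L M k ⊗ₖ (1 : Matrix o o ℂ)) ((L : ℝ) ^ d)
      (fun k => (calDalev L M a ha k ⊗ₖ (1 : Matrix o o ℂ))⁻¹)
      (Cpert (kappaBs o d a 0 0 (a * (epsR o d 0 * (2 + epsR o d 0) * Cst d a)) (kappa4F d a a' 0 0))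
        (2 * d * Cst d a) (CJ d a)
        (C2Bs o d L a 0 0 0
          (a * C2gram (Cst d a) 1 (epsR o d 0) (2 * d * Cst d a) (CJ d a) (Cst d a) (CdeltaR o d a 0 (theta0 d 0 (betaNE3 o 0))))
          (C4F o d L a a' 0 0 0)) 0 1) ((L : ℝ)⁻¹) := by
  have h := balaban_final_rate_flat L M a ha (o := o) hL hd ha'
  rw [balabanPert_flat L M a a'] at h
  simpa only [add_zero] using h

end Summit.QuantumFields.BalabanUV.T4Continuum.NE2BalabanFlatWitness

end
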